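import Literature.NumberTheory.EllipticCurves.PAdicLFunctionIntegralityProofs
import Literature.NumberTheory.EllipticCurves.PAdicBSDProofs
import HarnessLib

/-!
# Integrality of the `2`-adic `L`-function: `L₂(E, T) ∈ Λ = ℤ₂⟦T⟧` when `E[2]` is irreducible
# (the `p = 2` companion of `padicLFunction_mem_integral`; Greenberg–Vatsal 2000, Prop. 3.7 shape)

A *proofs* file (theorems only: no definition, no named fact; D-0014/D-0026), sibling of
`Literature.NumberTheory.EllipticCurves.PAdicLFunctionIntegralityProofs`. That file proves the named
fact `padicLFunction_mem_integral` — for `p` ODD, good ordinary, `E[p]` irreducible, every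
coefficient of `L_p(E, T) = L_p(f, α, T)` lies in `ℤ_p` — from the single arithmetic input
`not_irreducible_of_frobeniusTrace_congr` (Darmon–Diamond–Taylor 1995, Prop. 2.6(b); discharged in
`ModPReducibilityProofs`, `not_irreducible_of_frobeniusTrace_congr_holds`). Its binder `hp2 : p ≠ 2`
is consumed at exactly ONE place, `norm_ratPlusSymbol_le_one` (`‖4‖_p = 1`, from
`[x]⁺_f = k/(4 n₀)`), where the `4 = 2 × 2` is (i) `re Λ_f = ℤ · Ω⁺_f/2` (definition of `plusPeriod`,
item C9) and (ii) the plus symbol `({∞,x} + {∞,−x})/2` bounded WITHOUT using `{∞,−x} = conj {∞,x}`.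

THIS file proves the `p = 2` companion, for the SAME object (`padicLCoeff f (unitRoot W 2) k`, the
tree's Mazur–Tate–Teitelbaum `2`-adic `L`-function of the newform `f` of `E`, periods `Ω⁺_f`, cyclotomic
variable `γ = 5`, `Δ = {±1}`; `PAdicLFunction.lean`):

* §1 (`exists_normalizedPlusSymbol_eq_div_two`, `exists_ratPlusSymbol_eq_div_two`,
  `norm_ratPlusSymbol_two_le_two`): for `f` with REAL coefficients, `plusSymbol f x = re {∞, x}_f`
  (`plusSymbol_eq_re_holds`, Cremona §2.8), so (ii) disappears: `[x]⁺_f = k/(2 n₀)` at every cusp `x`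
  with denominator prime to `N`, given an Eisenstein multiple `n₀ {∞,0}_f ∈ Λ_f`; hence
  `‖[x]⁺_f‖₂ ≤ 2` when `n₀` is odd.
* §2 (`ratPlusSymbol_neg`, `msdMeasure_neg`): `[−r]⁺ = [r]⁺` and the Mazur–Swinnerton-Dyer
  distribution is EVEN, `μ_{f,α}(−a + pᵐℤ_p) = μ_{f,α}(a + pᵐℤ_p)` (any `p`; translation invariance
  `[r + n]⁺ = [r]⁺`, `ratPlusSymbol_add_intCast_eq`).
* §3 (`padicLRiemannSum_two`): at `p = 2` the torsion of `ℤ₂^×` is `{±1}` (`torsionOrder 2 = 2`,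
  `cyclotomicExponent 2 = 2`, `cyclotomicGenerator 2 = 5`), and by §2 the `ξ = −1` half of every
  Riemann sum equals the `ξ = 1` half: `padicLRiemannSum f α k n = 2 · Σ_s μ(5ˢ + 2ⁿ⁺²ℤ₂)·C(s,k)` —
  the `Δ`-doubling, which cancels the remaining `½` of (i).
* §4 (`norm_msdMeasure_two_le_two`, `norm_padicLCoeff_unitRoot_two_le_one`,
  **`padicLFunction_integral_two`**): for `E = W/ℚ` good ordinary at `2` (`2 ∤ N`, `a₂` odd),
  `f` its newform and `E[2]` irreducible: `‖μ_{f,α}(a + 2ᵐℤ₂)‖ ≤ 2`, every Riemann sum has norm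
  `≤ ‖2‖₂ · 2 = 1`, the sums converge to the coefficient (`tendsto_padicLRiemannSum_of_norm_le`,
  distribution relation `msdMeasure_distribution_of_isNewformOf`), the unit ball is closed — so EVERY
  coefficient of `L₂(f, α, T)` lies in `ℤ₂`, UNCONDITIONALLY (the arithmetic input is the discharged
  `not_irreducible_of_frobeniusTrace_congr_holds`: at `2`, `E[2]` irreducible ⇒ some good odd `ℓ`
  has `a_ℓ − ℓ − 1` odd).

STATUS IN PRINT. Greenberg–Vatsal 2000 Prop. 3.7 and Stevens 1989 are written for odd `p`; at
`p = 2` the statement for THIS normalisation (`Ω⁺_f`, `Δ`-pushforward included) is not printed as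
such — it is a theorem of the tree's definitions proved here by the printed mechanism (Manin's
cusp relation, the Hecke/Eisenstein relation at one good `ℓ`, Chebotarev + Brauer–Nesbitt).
Wuthrich, *Doc. Math.* 2014, p. 3 ("does not hold in general for `p = 2`") concerns Néron-lattice
symbols of curves WITH rational `2`-power torsion (class 17a), outside the `E[2]`-irreducible locus.
Requested by the residual cell `b2b-bsdres` (class O1 = X5 at `p = 2`; o1 lead PLAN v2.2 C25c
"T-INT2 / G12": on the `E[2]`-irreducible good-ordinary locus the slot `ν₂ := min{e : 2^e L₂ ∈ Λ}`
is `0` BY THEOREM, so the `k` of the cell's target `O1.KatoDivisibilityAtTwoUpTo W k f` measures only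
Euler-system losses at `2`). EVIDENCE before this proof (census, not used): `μ(ϖ·L₂) = 0` certified
on all 1 031 `E[2]`-irreducible rows with `N ≤ 1000`, `4 ∤ N` (o1 lens-1 GEN 2, P2a).

## References

* R. Greenberg, V. Vatsal, *On the Iwasawa invariants of elliptic curves*, Invent. Math. 142
  (2000), 17–63, §3, Prop. (3.7) (odd `p`; mechanism). [GreenbergVatsal2000]
* G. Stevens, *Stickelberger elements and modular parametrizations of elliptic curves*, Invent.
  Math. 98 (1989), 75–106, §4. [Stevens1989]
* B. Mazur, J. Tate, J. Teitelbaum, *On `p`-adic analogues of the conjectures of Birch and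
  Swinnerton-Dyer*, Invent. Math. 84 (1986), §I.10, §I.13 (`p = 2`: `Γ = 1 + 4ℤ₂`, `Δ = {±1}`).
  [MazurTateTeitelbaum1986Invent]
* J. E. Cremona, *Algorithms for modular elliptic curves*, 2nd ed., CUP 1997, §2.8.
  [CremonaAlgorithms1997]
* H. Darmon, F. Diamond, R. Taylor, *Fermat's Last Theorem* (1995), Prop. 2.6(b).
  [DarmonDiamondTaylor1995]
* C. Wuthrich, *On the integrality of modular symbols and Kato's Euler system for elliptic curves*,
  Doc. Math. 19 (2014), p. 3 (the `p = 2` caveat for Néron-lattice symbols). [Wuthrich2014]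
-/

noncomputable section

open scoped MatrixGroups ModularForm

open CongruenceSubgroup Filter Topology Literature.NumberTheory.EllipticCurves.ModularForms

namespace Literature.NumberTheory.EllipticCurves.ModularForms

/-! ### §1. Denominators `2 n₀` (not `4 n₀`) for real-coefficient forms -/

section Symbols

variable {N : ℕ} [NeZero N] (f : CuspForm (Gamma0 N) 2)

/-- **Denominators of `[x]` at cusps equivalent to `0`, real coefficients**: if all Fourier
coefficients of `f` are real, `n₀ {∞, 0}_f ∈ Λ_f` (`n₀ ≠ 0`) and `gcd(den x, N) = 1`, then
`[x]_f = re {∞, x}_f / Ω⁺_f = k / (2 n₀)` for some `k ∈ ℤ` — versus `k/(4 n₀)` in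
`exists_normalizedPlusSymbol_eq_div` (which does not use `{∞, −x} = conj {∞, x}`):
`plusSymbol f x = re {∞, x}` (`plusSymbol_eq_re_holds`), `re {∞, x} ≡ re {∞, 0} (mod ℤ Ω⁺/2)`
(`modularSymbol_sub_zero_mem_periodLattice`) and `re {∞, 0} ∈ (Ω⁺/(2n₀)) ℤ`; junk case `Ω⁺_f = 0`
gives `[x] = 0`. (Cremona 1997, §2.8: "`Ω(f)` is twice the least real part of a period".)
[cite: CremonaAlgorithms1997, §2.8] -/
theorem exists_normalizedPlusSymbol_eq_div_two (hreal : ∀ n, (cuspCoeff f n).im = 0) {n₀ : ℤ}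
    (hn₀ : n₀ ≠ 0) (h0 : (n₀ : ℂ) * modularSymbol f 0 ∈ periodLattice f) {x : ℚ}
    (hx : Nat.Coprime x.den N) :
    ∃ k : ℤ, normalizedPlusSymbol f x = (k : ℝ) / (2 * n₀) := by
  by_cases hΩ : plusPeriod f = 0
  · exact ⟨0, by rw [normalizedPlusSymbol_eq_zero_of_plusPeriod_eq_zero f hΩ]; simp⟩
  obtain ⟨hre, hpos⟩ := realPeriods_eq_zmultiples_of_plusPeriod_ne_zero f hΩ
  obtain ⟨k₁, hk₁⟩ := exists_re_eq_add_of_sub_mem f hre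
    (modularSymbol_sub_zero_mem_periodLattice f hx)
  obtain ⟨k₀, hk₀⟩ := exists_re_eq_div_of_intCast_mul_mem f hre hn₀ h0
  refine ⟨k₀ + n₀ * k₁, ?_⟩
  have hn₀' : (n₀ : ℝ) ≠ 0 := by exact_mod_cast hn₀
  rw [normalizedPlusSymbol, plusSymbol_eq_re_holds f hreal x, Complex.ofReal_re, hk₁, hk₀]
  push_cast
  field_simp

/-- **The rational plus symbol at a cusp equivalent to `0`, real coefficients**:
`[x]⁺_f = ratPlusSymbol f x = k / (2 n₀)` for some `k ∈ ℤ` (the `dite` in `ratPlusSymbol` fires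
since `[x]_f` is rational). [cite: CremonaAlgorithms1997, §2.8] -/
theorem exists_ratPlusSymbol_eq_div_two (hreal : ∀ n, (cuspCoeff f n).im = 0) {n₀ : ℤ}
    (hn₀ : n₀ ≠ 0) (h0 : (n₀ : ℂ) * modularSymbol f 0 ∈ periodLattice f) {x : ℚ}
    (hx : Nat.Coprime x.den N) :
    ∃ k : ℤ, ratPlusSymbol f x = (k : ℚ) / (2 * n₀) := by
  obtain ⟨k, hk⟩ := exists_normalizedPlusSymbol_eq_div_two f hreal hn₀ h0 hx
  have hex : ∃ q : ℚ, (q : ℝ) = normalizedPlusSymbol f x :=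
    ⟨(k : ℚ) / (2 * n₀), by rw [hk]; push_cast; rfl⟩
  refine ⟨k, ?_⟩
  rw [ratPlusSymbol, dif_pos hex]
  apply Rat.cast_injective (α := ℝ)
  rw [hex.choose_spec, hk]
  push_cast
  rfl

/-- **`‖[x]⁺_f‖₂ ≤ 2` at cusps equivalent to `0`** for a real-coefficient `f` with an ODD
Eisenstein multiple `n₀ {∞, 0}_f ∈ Λ_f`: `‖k/(2n₀)‖₂ = 2‖k‖₂ ≤ 2`. (At odd `p` the same symbols are
`p`-integral, `norm_ratPlusSymbol_le_one`; at `2` one factor `½` survives at the symbol level and is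
cancelled only inside the Riemann sums, `padicLRiemannSum_two`.) [cite: CremonaAlgorithms1997, §2.8] -/
theorem norm_ratPlusSymbol_two_le_two (hreal : ∀ n, (cuspCoeff f n).im = 0) {n₀ : ℤ}
    (h2n₀ : ¬ (2 : ℤ) ∣ n₀) (h0 : (n₀ : ℂ) * modularSymbol f 0 ∈ periodLattice f) {x : ℚ}
    (hx : Nat.Coprime x.den N) :
    ‖((ratPlusSymbol f x : ℚ) : ℚ_[2])‖ ≤ 2 := by
  have hn₀ : n₀ ≠ 0 := by rintro rfl; exact h2n₀ (dvd_zero _)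
  obtain ⟨k, hk⟩ := exists_ratPlusSymbol_eq_div_two f hreal hn₀ h0 hx
  have hn : ‖((n₀ : ℤ) : ℚ_[2])‖ = 1 :=
    le_antisymm (Padic.norm_int_le_one _)
      (not_lt.mp fun hlt ↦ h2n₀ (by exact_mod_cast Padic.norm_intCast_lt_one_iff.mp hlt))
  have h2 : ‖(2 : ℚ_[2])‖ = (2 : ℝ)⁻¹ := by
    have h := Padic.norm_p (p := 2)
    simpa using h
  rw [hk]
  push_cast
  rw [norm_div, norm_mul, h2, hn, mul_one]
  have hk1 : ‖((k : ℤ) : ℚ_[2])‖ ≤ 1 := Padic.norm_int_le_one k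
  calc ‖((k : ℤ) : ℚ_[2])‖ / (2 : ℝ)⁻¹ = 2 * ‖((k : ℤ) : ℚ_[2])‖ := by
        rw [div_eq_mul_inv, inv_inv, mul_comm]
    _ ≤ 2 * 1 := by gcongr
    _ = 2 := mul_one _

/-! ### §2. Evenness: `[−r]⁺ = [r]⁺` and `μ(−a) = μ(a)` -/

omit [NeZero N] in
/-- `plusSymbol f (−r) = plusSymbol f r`: the plus symbol `({∞, r} + {∞, −r})/2` is even by
construction (Mazur–Tate–Teitelbaum 1986, §I.8; Cremona 1997, §2.8).
[cite: MazurTateTeitelbaum1986Invent, §I.8] -/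
theorem plusSymbol_neg (r : ℚ) : plusSymbol f (-r) = plusSymbol f r := by
  simp only [plusSymbol, neg_neg, add_comm]

omit [NeZero N] in
/-- `[−r]⁺_f = [r]⁺_f`: the rational plus symbol is even (it depends on `r` only through
`plusSymbol f r`; Mazur–Tate–Teitelbaum 1986, §I.8, "`[r]⁺ = [−r]⁺`").
[cite: MazurTateTeitelbaum1986Invent, §I.8] -/
theorem ratPlusSymbol_neg (r : ℚ) : ratPlusSymbol f (-r) = ratPlusSymbol f r := by
  have h3 : normalizedPlusSymbol f (-r) = normalizedPlusSymbol f r := by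
    simp only [normalizedPlusSymbol, plusSymbol_neg]
  unfold ratPlusSymbol
  rw [h3]

end Symbols

end Literature.NumberTheory.EllipticCurves.ModularForms

namespace Literature.NumberTheory.EllipticCurves

section Measure

variable {N : ℕ} [NeZero N] (f : CuspForm (Gamma0 N) 2) {p : ℕ} [Fact p.Prime]

/-- **The Mazur–Swinnerton-Dyer distribution is even**: `μ_{f,α}(−a + pᵐℤ_p) = μ_{f,α}(a + pᵐℤ_p)`.
For `m = 0` there is nothing to prove; for `m + 1` and `a ≠ 0` the representative of `−a` is
`p^{m+1} − a.val`, and `[(p^{m+1} − v)/p^{m+1}]⁺ = [1 − v/p^{m+1}]⁺ = [−v/p^{m+1}]⁺ = [v/p^{m+1}]⁺`,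
`[(p^{m+1} − v)/p^m]⁺ = [p − v/p^m]⁺ = [v/p^m]⁺` by translation invariance
(`ratPlusSymbol_add_intCast_eq`) and evenness (`ratPlusSymbol_neg`).
[cite: MazurTateTeitelbaum1986Invent, §I.10 (10.1) and §I.4 (4.2)] -/
theorem msdMeasure_neg (α : ℚ_[p]) : ∀ (m : ℕ) (a : ZMod (p ^ m)),
    msdMeasure f α m (-a) = msdMeasure f α m a
  | 0, _ => by simp only [msdMeasure]
  | m + 1, a => by
    have hp : p.Prime := Fact.out
    by_cases ha : a = 0
    · subst ha; rw [neg_zero]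
    haveI : NeZero (p ^ (m + 1)) := ⟨pow_ne_zero _ hp.ne_zero⟩
    have hval : (-a).val = p ^ (m + 1) - a.val := by rw [ZMod.neg_val, if_neg ha]
    have hlt : a.val ≤ p ^ (m + 1) := (ZMod.val_lt a).le
    have hcast : (((-a).val : ℕ) : ℚ) = (p : ℚ) ^ (m + 1) - (a.val : ℚ) := by
      rw [hval, Nat.cast_sub hlt]; push_cast; ring
    have hp0 : (p : ℚ) ≠ 0 := by exact_mod_cast hp.ne_zero
    have h1 : ratPlusSymbol f ((((-a).val : ℕ) : ℚ) / (p : ℚ) ^ (m + 1)) =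
        ratPlusSymbol f (((a.val : ℕ) : ℚ) / (p : ℚ) ^ (m + 1)) := by
      have e : (((-a).val : ℕ) : ℚ) / (p : ℚ) ^ (m + 1) =
          -(((a.val : ℕ) : ℚ) / (p : ℚ) ^ (m + 1)) + ((1 : ℤ) : ℚ) := by
        rw [hcast]; push_cast; field_simp; ring
      rw [e, ratPlusSymbol_add_intCast_eq, ratPlusSymbol_neg]
    have h2 : ratPlusSymbol f ((((-a).val : ℕ) : ℚ) / (p : ℚ) ^ m) =
        ratPlusSymbol f (((a.val : ℕ) : ℚ) / (p : ℚ) ^ m) := by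
      have e : (((-a).val : ℕ) : ℚ) / (p : ℚ) ^ m =
          -(((a.val : ℕ) : ℚ) / (p : ℚ) ^ m) + ((p : ℤ) : ℚ) := by
        rw [hcast]; push_cast; field_simp; ring
      rw [e, ratPlusSymbol_add_intCast_eq, ratPlusSymbol_neg]
    simp only [msdMeasure, h1, h2]

end Measure

/-! ### §3. The `Δ = {±1}` doubling of the Riemann sums at `p = 2` -/

section Two

variable {N : ℕ} [NeZero N] (f : CuspForm (Gamma0 N) 2)

/-- `e₀(2) = 2`: `Γ = 1 + 4ℤ₂` (MTT 1986 §I.13). [cite: MazurTateTeitelbaum1986Invent, §I.13] -/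
theorem cyclotomicExponent_two : cyclotomicExponent 2 = 2 := by
  simp [cyclotomicExponent]

/-- `γ = 5` at `p = 2` (topological generator of `1 + 4ℤ₂`). [cite: MazurTateTeitelbaum1986Invent, §I.13] -/
theorem cyclotomicGenerator_two : cyclotomicGenerator 2 = 5 := by
  simp [cyclotomicGenerator, cyclotomicExponent]

/-- The torsion of `ℤ₂^×` used by the Riemann sums has order `φ(4) = 2` (it is `{±1}`).
[cite: MazurTateTeitelbaum1986Invent, §I.13] -/
theorem torsionOrder_two : torsionOrder 2 = 2 := by
  simp only [torsionOrder, cyclotomicExponent, if_true]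
  decide

/-- The `2`-adic roots of unity of order dividing `2` are `±1` (ℤ₂ is a domain of characteristic
`0`); private helper. [folklore] -/
private theorem coe_rootsOfUnity_two_eq_or (ξ : rootsOfUnity 2 ℤ_[2]) :
    ((ξ : ℤ_[2]ˣ) : ℤ_[2]) = 1 ∨ ((ξ : ℤ_[2]ˣ) : ℤ_[2]) = -1 := by
  have h := ξ.2
  rw [mem_rootsOfUnity] at h
  have h' : (((ξ : ℤ_[2]ˣ) : ℤ_[2])) ^ 2 = 1 := by
    rw [← Units.val_pow_eq_pow_val, h, Units.val_one]
  exact sq_eq_one_iff.mp h'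

/-- **The `Δ`-doubling at `p = 2`**: every Riemann sum of the `2`-adic `L`-function is TWICE the
sum over the `ξ = 1` fibre,
`padicLRiemannSum f α k n = 2 · Σ_{s mod 2ⁿ} μ_{f,α}(5ˢ + 2ⁿ⁺²ℤ₂) · C(s, k)`,
because the torsion of `ℤ₂^×` is `{±1}` and `μ_{f,α}(−b) = μ_{f,α}(b)` (`msdMeasure_neg`). This is
the tree-object form of "every Mazur–Tate coefficient at `2` is `2ν(g)`" (o1 lens-1 G2-A3).
[cite: MazurTateTeitelbaum1986Invent, §I.13 (p = 2: Δ = {±1}, γ = 5)] -/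
theorem padicLRiemannSum_two (α : ℚ_[2]) (k n : ℕ) :
    padicLRiemannSum f α k n =
      2 * ∑ s : ZMod (2 ^ n),
        msdMeasure f α (n + 2) ((cyclotomicGenerator 2 : ZMod (2 ^ (n + 2))) ^ s.val) *
          (s.val.choose k : ℚ_[2]) := by
  classical
  -- the summand as a function of the Teichmüller representative
  set G : ℤ_[2] → ℚ_[2] := fun u ↦ ∑ s : ZMod (2 ^ n),
    msdMeasure f α (n + 2) (PadicInt.toZModPow (n + 2) u *
        (cyclotomicGenerator 2 : ZMod (2 ^ (n + 2))) ^ s.val) * (s.val.choose k : ℚ_[2]) with hG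
  have hG1 : G 1 = ∑ s : ZMod (2 ^ n),
      msdMeasure f α (n + 2) ((cyclotomicGenerator 2 : ZMod (2 ^ (n + 2))) ^ s.val) *
        (s.val.choose k : ℚ_[2]) := by
    simp only [hG, map_one, one_mul]
  have hGneg : G (-1) = G 1 := by
    simp only [hG, map_neg, map_one, neg_one_mul, one_mul, msdMeasure_neg]
  -- the torsion group at `2` is `{1, ζ}` with `ζ = -1`
  have hζmem : (-1 : ℤ_[2]ˣ) ∈ rootsOfUnity 2 ℤ_[2] := by
    rw [mem_rootsOfUnity]; norm_num
  set ζ : rootsOfUnity 2 ℤ_[2] := ⟨-1, hζmem⟩ with hζ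
  have hne : (1 : rootsOfUnity 2 ℤ_[2]) ≠ ζ := by
    intro h
    have h' : (((1 : rootsOfUnity 2 ℤ_[2]) : ℤ_[2]ˣ) : ℤ_[2]) = ((ζ : ℤ_[2]ˣ) : ℤ_[2]) := by
      rw [h]
    rw [hζ] at h'
    simp only [OneMemClass.coe_one, Units.val_one, Units.val_neg] at h'
    have h2 : (2 : ℤ_[2]) = 0 := by linear_combination h'
    exact two_ne_zero h2
  haveI : Fintype (rootsOfUnity 2 ℤ_[2]) := Fintype.ofFinite _
  have huniv : (Finset.univ : Finset (rootsOfUnity 2 ℤ_[2])) = {1, ζ} := by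
    ext ξ
    simp only [Finset.mem_univ, Finset.mem_insert, Finset.mem_singleton, true_iff]
    rcases coe_rootsOfUnity_two_eq_or ξ with h | h
    · left
      exact Subtype.ext (Units.ext (by simpa using h))
    · right
      exact Subtype.ext (Units.ext (by rw [hζ]; simpa using h))
  -- unfold the Riemann sum at `p = 2`
  have hRS : padicLRiemannSum f α k n =
      ∑ᶠ ξ : rootsOfUnity (torsionOrder 2) ℤ_[2], G ((ξ : ℤ_[2]ˣ) : ℤ_[2]) := by
    rw [padicLRiemannSum]
    rfl
  rw [hRS, torsionOrder_two, finsum_eq_sum_of_fintype, huniv, Finset.sum_pair hne]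
  simp only [OneMemClass.coe_one, Units.val_one, hζ, Units.val_neg]
  rw [hGneg, hG1, two_mul]

end Two

/-! ### §4. `μ_{f,α}` is `½ℤ₂`-valued at `2`, and `L₂(f, α, T) ∈ ℤ₂⟦T⟧` -/

section Assembly

variable {N : ℕ} [NeZero N] {f : CuspForm (Gamma0 N) 2}
  {W : WeierstrassCurve ℚ} [W.IsElliptic] [W.IsGloballyMinimal]

/-- **`‖μ_{f,α}(a + 2ᵐℤ₂)‖ ≤ 2`** for the unit root `α` at a good ordinary `2`, `f` the newform of
`E = W` (real coefficients, `2 ∤ N`), given an ODD Eisenstein multiple `n₀ {∞, 0}_f ∈ Λ_f`: the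
symbols `[a/2ᵐ]⁺` have norm `≤ 2` (`norm_ratPlusSymbol_two_le_two`, denominators of `a/2ᵐ` prime to
`N` by `coprime_den_div_prime_pow`), `‖α⁻¹‖ = 1` (`unitRoot_coe_spec`), ultrametric inequality.
[cite: MazurTateTeitelbaum1986Invent, §I.10 (10.1)] -/
theorem norm_msdMeasure_two_le_two (hord : IsOrdinaryAt W 2) (hf : IsNewformOf W f) {n₀ : ℤ}
    (h2n₀ : ¬ (2 : ℤ) ∣ n₀) (h0 : (n₀ : ℂ) * modularSymbol f 0 ∈ periodLattice f) (m : ℕ)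
    (a : ZMod (2 ^ m)) : ‖msdMeasure f (unitRoot W 2 : ℚ_[2]) m a‖ ≤ 2 := by
  have hpN : ¬ 2 ∣ N := not_dvd_level_of_isNewformOf hf hord.1
  have hreal : ∀ n, (cuspCoeff f n).im = 0 :=
    cuspCoeff_im_eq_zero_of_coeffField_eq_bot hf.coeffField_eq_bot
  have hsym : ∀ m k : ℕ, ‖((ratPlusSymbol f ((m : ℚ) / (2 : ℚ) ^ k) : ℚ) : ℚ_[2])‖ ≤ 2 := by
    intro m k
    have h := norm_ratPlusSymbol_two_le_two f hreal h2n₀ h0 (coprime_den_div_prime_pow hpN m k)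
    exact_mod_cast h
  set α : ℚ_[2] := (unitRoot W 2 : ℚ_[2]) with hα
  have hαu : ‖α‖ = 1 := (unitRoot_coe_spec (W := W) hord).2.1
  have hαi : ‖α⁻¹‖ = 1 := by rw [norm_inv, hαu, inv_one]
  cases m with
  | zero =>
    have h00 : ‖((ratPlusSymbol f 0 : ℚ) : ℚ_[2])‖ ≤ 2 := by
      have h := hsym 0 0
      rwa [Nat.cast_zero, zero_div] at h
    simp only [msdMeasure]
    rw [norm_mul]
    have h1 : ‖(1 : ℚ_[2]) - α⁻¹‖ ≤ 1 := by
      calc ‖(1 : ℚ_[2]) - α⁻¹‖ = ‖(1 : ℚ_[2]) + -α⁻¹‖ := by rw [sub_eq_add_neg]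
        _ ≤ max ‖(1 : ℚ_[2])‖ ‖-α⁻¹‖ := Padic.nonarchimedean _ _
        _ = 1 := by rw [norm_neg, norm_one, hαi, max_self]
    calc _ ≤ (1 : ℝ) * 2 := mul_le_mul h1 h00 (norm_nonneg _) zero_le_one
      _ = 2 := one_mul _
  | succ m =>
    simp only [msdMeasure]
    have hA : ‖α⁻¹ ^ (m + 1) * ((ratPlusSymbol f ((a.val : ℚ) / (2 : ℚ) ^ (m + 1)) : ℚ) : ℚ_[2])‖
        ≤ 2 := by
      rw [norm_mul, norm_pow, hαi, one_pow, one_mul]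
      exact hsym _ _
    have hB : ‖α⁻¹ ^ (m + 2) * ((ratPlusSymbol f ((a.val : ℚ) / (2 : ℚ) ^ m) : ℚ) : ℚ_[2])‖
        ≤ 2 := by
      rw [norm_mul, norm_pow, hαi, one_pow, one_mul]
      exact hsym _ _
    have hcast : ((2 : ℕ) : ℚ) = (2 : ℚ) := by norm_num
    rw [hcast]
    calc _ ≤ max ‖α⁻¹ ^ (m + 1) * ((ratPlusSymbol f ((a.val : ℚ) / (2 : ℚ) ^ (m + 1)) : ℚ) : ℚ_[2])‖
          ‖-(α⁻¹ ^ (m + 2) * ((ratPlusSymbol f ((a.val : ℚ) / (2 : ℚ) ^ m) : ℚ) : ℚ_[2]))‖ := by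
          rw [sub_eq_add_neg]
          exact Padic.nonarchimedean _ _
      _ ≤ 2 := by
          rw [norm_neg]
          exact max_le hA hB

/-- **`2`-integrality of the coefficients of `L₂(E, T)` from one odd Eisenstein multiple**: for
`E = W` good ordinary at `2`, `f` its newform, and `n₀ {∞, 0}_f ∈ Λ_f` with `n₀` odd, every
coefficient of `L₂(f, α, T)` (`α` the unit root) has `‖·‖₂ ≤ 1`: by the doubling
(`padicLRiemannSum_two`) each Riemann sum is `2 × (sum of terms of norm ≤ 2)`, so of norm
`≤ ‖2‖₂ · 2 = 1`; the sums converge to the coefficient (`tendsto_padicLRiemannSum_of_norm_le` with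
`msdMeasure_distribution_of_isNewformOf` and the bound `2`), and the unit ball of `ℚ₂` is closed.
[cite: MazurTateTeitelbaum1986Invent, §I.10–§I.13] -/
theorem norm_padicLCoeff_unitRoot_two_le_one (hord : IsOrdinaryAt W 2) (hf : IsNewformOf W f)
    {n₀ : ℤ} (h2n₀ : ¬ (2 : ℤ) ∣ n₀) (h0 : (n₀ : ℂ) * modularSymbol f 0 ∈ periodLattice f)
    (k : ℕ) : ‖padicLCoeff f (unitRoot W 2 : ℚ_[2]) k‖ ≤ 1 := by
  have hμ : ∀ (m : ℕ) (a : ZMod (2 ^ m)), ‖msdMeasure f (unitRoot W 2 : ℚ_[2]) m a‖ ≤ 2 :=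
    norm_msdMeasure_two_le_two hord hf h2n₀ h0
  have h2 : ‖(2 : ℚ_[2])‖ = (2 : ℝ)⁻¹ := by
    have h := Padic.norm_p (p := 2)
    simpa using h
  have hRS : ∀ n, ‖padicLRiemannSum f (unitRoot W 2 : ℚ_[2]) k n‖ ≤ 1 := by
    intro n
    rw [padicLRiemannSum_two]
    have hS : ‖∑ s : ZMod (2 ^ n),
        msdMeasure f (unitRoot W 2 : ℚ_[2]) (n + 2)
            ((cyclotomicGenerator 2 : ZMod (2 ^ (n + 2))) ^ s.val) *
          (s.val.choose k : ℚ_[2])‖ ≤ 2 := by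
      refine IsUltrametricDist.norm_sum_le_of_forall_le_of_nonneg zero_le_two fun s _ ↦ ?_
      have hc : ‖((s.val.choose k : ℕ) : ℚ_[2])‖ ≤ 1 := by
        have h := Padic.norm_int_le_one (p := 2) ((s.val.choose k : ℕ) : ℤ)
        rwa [Int.cast_natCast] at h
      rw [norm_mul]
      calc ‖msdMeasure f (unitRoot W 2 : ℚ_[2]) (n + 2)
              ((cyclotomicGenerator 2 : ZMod (2 ^ (n + 2))) ^ s.val)‖ *
            ‖((s.val.choose k : ℕ) : ℚ_[2])‖ ≤ 2 * 1 :=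
            mul_le_mul (hμ _ _) hc (norm_nonneg _) zero_le_two
        _ = 2 := mul_one _
    rw [norm_mul, h2]
    calc (2 : ℝ)⁻¹ * _ ≤ (2 : ℝ)⁻¹ * 2 := by gcongr
      _ = 1 := by norm_num
  exact le_of_tendsto
    (tendsto_padicLRiemannSum_of_norm_le (msdMeasure_distribution_of_isNewformOf hord hf)
      ⟨2, hμ⟩ k).norm (Eventually.of_forall hRS)

/-- **Integrality of `L₂(E, T)` when `E[2]` is irreducible (the `p = 2` companion of
`padicLFunction_mem_integral`, UNCONDITIONAL).** For `E = W/ℚ` globally minimal, good ordinary at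
`2`, `f` its newform (any level `N`) and `ρ̄_{E,2}` irreducible (i.e. `E(ℚ)[2] = 0`): every
coefficient of the `2`-adic `L`-function `L₂(f, α, T)` (`α` the unit root; periods `Ω⁺_f`,
`γ = 5`, `Δ = {±1}`) lies in `ℤ₂`. The arithmetic input is the discharged named fact
`not_irreducible_of_frobeniusTrace_congr_holds` (DDT Prop. 2.6(b): an irreducible `E[2]` has a good
prime `ℓ` with `a_ℓ − ℓ − 1` odd), via `exists_intCast_mul_modularSymbol_zero_mem`; then
`norm_padicLCoeff_unitRoot_two_le_one`. Greenberg–Vatsal 2000 Prop. 3.7 / Stevens 1989 §4 print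
the odd-`p` statement; at `2` this is a theorem of the tree's normalisation by the same mechanism
plus the `Δ`-doubling. [cite: GreenbergVatsal2000, Prop. 3.7 (mechanism; odd p in print)]
[cite: DarmonDiamondTaylor1995, Prop. 2.6(b)] -/
theorem padicLFunction_integral_two (hord : IsOrdinaryAt W 2) (hf : IsNewformOf W f)
    (hirr : W.HasIrreducibleModPGaloisRep 2) (k : ℕ) :
    ‖padicLCoeff f (unitRoot W 2 : ℚ_[2]) k‖ ≤ 1 := by
  obtain ⟨n₀, h2n₀, h0⟩ := exists_intCast_mul_modularSymbol_zero_mem (p := 2)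
    not_irreducible_of_frobeniusTrace_congr_holds hf hirr
  exact norm_padicLCoeff_unitRoot_two_le_one hord hf h2n₀ h0 k

/-- **Integrality of `L₂(E, T)`, coefficient form**: under the hypotheses of
`padicLFunction_integral_two`, `‖[T^k] L₂(f, α, T)‖₂ ≤ 1` for every `k`.
[cite: GreenbergVatsal2000, Prop. 3.7 (mechanism; odd p in print)] -/
theorem norm_coeff_padicLFunction_two_le_one (hord : IsOrdinaryAt W 2) (hf : IsNewformOf W f)
    (hirr : W.HasIrreducibleModPGaloisRep 2) (k : ℕ) :
    ‖PowerSeries.coeff k (padicLFunction f (unitRoot W 2 : ℚ_[2]))‖ ≤ 1 := by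
  rw [coeff_padicLFunction]
  exact padicLFunction_integral_two hord hf hirr k

/-- **`L₂(E, T) ∈ Λ = ℤ₂⟦T⟧` when `E[2]` is irreducible** (the `p = 2` companion of bsd.S23
`exists_iwasawaToPowerSeries_eq_padicLFunction`, which carries `p ≠ 2`): for `E = W/ℚ` globally
minimal, good ordinary at `2`, `f` its newform, `ρ̄_{E,2}` irreducible, there is `G ∈ ℤ₂⟦T⟧` with
`ι G = L₂(f, α, T)`. From `norm_coeff_padicLFunction_two_le_one` and the coefficientwise criterion
`exists_iwasawaToPowerSeries_eq_iff_norm_coeff_le_one` (Mazur–Tate–Teitelbaum 1986, §I.12: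
`Λ ↪ ℚ_p⟦T⟧` coefficientwise). In the residual cell's currency: the exponent `ν₂` in
"`2^{ν₂} L₂ ∈ Λ`" is `0` on the `E[2]`-irreducible good-ordinary locus.
[cite: MazurTateTeitelbaum1986Invent, §I.12] [cite: GreenbergVatsal2000, Prop. 3.7 (mechanism; odd p in print)] -/
theorem exists_iwasawaToPowerSeries_eq_padicLFunction_two (hord : IsOrdinaryAt W 2)
    (hf : IsNewformOf W f) (hirr : W.HasIrreducibleModPGaloisRep 2) :
    ∃ G : IwasawaAlgebra 2,
      iwasawaToPowerSeries 2 G = padicLFunction f (unitRoot W 2 : ℚ_[2]) :=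
  (exists_iwasawaToPowerSeries_eq_iff_norm_coeff_le_one _).mpr fun k ↦
    norm_coeff_padicLFunction_two_le_one hord hf hirr k

/-- Uniqueness of the integral `2`-adic `L`-function: `ι : Λ ↪ ℚ₂⟦T⟧` is injective
(`iwasawaToPowerSeries_injective`). [cite: MazurTateTeitelbaum1986Invent, §I.12] -/
theorem existsUnique_iwasawaToPowerSeries_eq_padicLFunction_two (hord : IsOrdinaryAt W 2)
    (hf : IsNewformOf W f) (hirr : W.HasIrreducibleModPGaloisRep 2) :
    ∃! G : IwasawaAlgebra 2,
      iwasawaToPowerSeries 2 G = padicLFunction f (unitRoot W 2 : ℚ_[2]) := by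
  obtain ⟨G, hG⟩ := exists_iwasawaToPowerSeries_eq_padicLFunction_two hord hf hirr
  exact ⟨G, hG, fun G' hG' ↦ iwasawaToPowerSeries_injective 2 (hG'.trans hG.symm)⟩

end Assembly

end Literature.NumberTheory.EllipticCurves

end
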